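import Literature.Analysis.FluidPDE.LinearisedNSFourierDefs
import HarnessLib

/-!
# Fourier-side objects for the linearised Navier–Stokes equation with a source on `T^d`: definitions

Analysis/FluidPDE definition file, first of the files `LinearisedNSFourierForced*`, the
INHOMOGENEOUS twin of the chain `LinearisedNSFourier{Defs, …, Solution}`: **existence of smooth
solutions of the linearised Navier–Stokes system along a smooth divergence-free field `u` with a
smooth mean-zero source `g`** on `[0, T] × T^d`,

  `∂ₜw + (u·∇)w + (w·∇)u + ∇q = νΔw + g`, `div w = 0`, `w(0) = w₀`, `∫ w(t) = 0`,

for `ν > 0`, `T > 0` (Constantin–Foias 1988, Ch. 14, (14.3)–(14.4) with an inhomogeneity: the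
second-variation equation of the Navier–Stokes semiflow, `g = -(w·∇)w`, and every inhomogeneous
linearised problem of the `C²` theory; Temam 1997, Ch. VI §8). The construction is that of the
homogeneous chain (objects in `LinearisedNSFourierDefs`: the linearised symbol `linSym`, its
Leray projection `linProjSym`, the clamped Duhamel map `picardMap ν T U a`), with the source
added to the mild formula exactly as the source `S` of the scalar construction
(`ScalarFourier.picardMap`): with `G ⱼ = ĝⱼ` the source coefficients, the pressure-free equation
is `∂ₜŵ = -νₖŵ - P[linSym] + P ĝ` and its mild form

  `c(l,t,k) = Φ(c)(l,t,k) + ∫₀^τ e^{-νₖ(τ-s)} (P ĝ(s))ₗ(k) ds`, `τ = clamp T t`,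

`Φ = picardMap ν T U a` the homogeneous Duhamel map — the **forcing term does not depend on
`c`**, so differences of the forced map are differences of the homogeneous map and the
contraction estimate of `LinearisedNSFourierPicard` applies verbatim. The pressure absorbs the
gradient parts of both the convective terms and the source: `q̂ = -(∑ₘ kₘ (linSymₘ - ĝₘ))/(2πi|k|²)`.
This file only names the objects:

* `srcProj G` — the Leray-projected source `(P(k) G(k))ₗ`; `presCoefF U G c` — the pressure
  coefficients; `forcing ν T G` — the Duhamel integral of the projected source;
* `picardMapF ν T U G a = picardMap ν T U a + forcing ν T G`, `picardIterF`, `picardLimF`,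
  `PicardHypF ν T U G a` (= `PicardHyp ν T U a` and continuity / every decay of `G`);
* `srcProjFamily`, `bootRHSF ν` — the projected source family and the bootstrap right-hand side
  `-νₖ CFₗ - (P linSym)ₗ + (P GF)ₗ` of the differentiated mild system;
* `solCoeffF ν T u g w₀`, `presCoeffFieldF`, `velCF`, `presCF`, `velF`, `presF` — the solution
  coefficients for a real background `u`, source `g` (coefficient data
  `CorrectorFourier.driftCoeff T u`, `CorrectorFourier.driftCoeff T g`) and datum `w₀`
  (`datumCoeff w₀`), the synthesized complex fields and their real parts.

All properties are proved in the sequel files (`LinearisedNSFourierForcedPicard`,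
`…Iteration`, `…TimeRegularity`, `…Data`, `…Synthesis`, `…Solution`).

## References

* P. Constantin, C. Foias, *Navier–Stokes Equations*, Univ. Chicago Press 1988, Ch. 14,
  (14.3)–(14.4). [`ConstantinFoiasNSE1988`]
* R. Temam, *Infinite-Dimensional Dynamical Systems in Mechanics and Physics*, 2nd ed., Springer
  1997, Ch. VI §3.1, (3.7)–(3.11), §8. [`Temam1997`]
* P. G. Lemarié-Rieusset, *The Navier–Stokes problem in the 21st century*, CRC 2016, §6.1, §8.5.
-/

noncomputable section

open MeasureTheory Real Set Filter Topology UnitAddTorus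

namespace Literature.Analysis.FluidPDE

namespace LinearisedNSFourier

open ScalarFourier
open CorrectorFourier (leraySym driftCoeff)
open FourierNS (HasDecay clamp)
open Literature.Analysis.FunctionSpaces.Torus (freqNormSq)

variable {d : Type*} [Fintype d]

/-! ### The projected source and the pressure coefficients -/

section Symbols

/-- The **Leray-projected source** `(P(k) G(k))ₗ = ∑ₘ P(k)ₗₘ Gₘ(k)` of a family of source
coefficients `G ⱼ = ĝⱼ` (`P = CorrectorFourier.leraySym`). [folklore] -/
def srcProj [DecidableEq d] (G : d → (d → ℤ) → ℂ) (l : d) (k : d → ℤ) : ℂ :=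
  ∑ m, leraySym l m k * G m k

/-- Unfolding `srcProj`. [folklore] -/
theorem srcProj_apply [DecidableEq d] (G : d → (d → ℤ) → ℂ) (l : d) (k : d → ℤ) :
    srcProj G l k = ∑ m, leraySym l m k * G m k := rfl

/-- The **pressure coefficients of the forced equation**
`q̂(k) = -(∑ₘ kₘ (linSymₘ(k) - Gₘ(k))) / (2πi |k|²)` (`q̂(0) = 0` by `x/0 = 0`): the solution of
`Δq = -div((u·∇)w + (w·∇)u - g)` (Lemarié-Rieusset 2016, §6.1). [folklore] -/
def presCoefF (U G c : d → (d → ℤ) → ℂ) (k : d → ℤ) : ℂ :=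
  -(∑ m, (k m : ℂ) * (linSym U c m k - G m k)) / (2 * π * Complex.I * (freqNormSq k : ℂ))

/-- Unfolding `presCoefF`. [folklore] -/
theorem presCoefF_apply (U G c : d → (d → ℤ) → ℂ) (k : d → ℤ) :
    presCoefF U G c k =
      -(∑ m, (k m : ℂ) * (linSym U c m k - G m k)) / (2 * π * Complex.I * (freqNormSq k : ℂ)) := rfl

end Symbols

/-! ### The forced Picard iteration on `[0, T]` -/

section Picard

variable [DecidableEq d]

/-- The **forcing term** of the mild formulation: the Duhamel integral of the projected source,
`∫₀^τ e^{-νₖ(τ-s)} (P G(s))ₗ(k) ds`, `τ = clamp T t` — independent of the unknown. [folklore] -/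
def forcing (ν T : ℝ) (G : d → ℝ → (d → ℤ) → ℂ) (l : d) (t : ℝ) (k : d → ℤ) : ℂ :=
  ∫ s in (0 : ℝ)..clamp T t, (heatFactor ν k (clamp T t - s) : ℂ) * srcProj (fun j => G j s) l k

/-- Unfolding `forcing`. [folklore] -/
theorem forcing_apply (ν T : ℝ) (G : d → ℝ → (d → ℤ) → ℂ) (l : d) (t : ℝ) (k : d → ℤ) :
    forcing ν T G l t k = ∫ s in (0 : ℝ)..clamp T t, (heatFactor ν k (clamp T t - s) : ℂ) *
      srcProj (fun j => G j s) l k := rfl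

/-- The **forced clamped Duhamel (Picard) map**: the homogeneous map plus the forcing term,
`Φ_G(c)(l,t,k) = e^{-νₖτ} a(l,k) - ∫₀^τ e^{-νₖ(τ-s)} (P linSym)(U(s), c(s))(l,k) ds
  + ∫₀^τ e^{-νₖ(τ-s)} (P G(s))ₗ(k) ds`, `τ = clamp T t` (on `[0, T]` the Duhamel formula for
`∂ₜcₗ = -νₖ cₗ - (P linSym)ₗ + (P G)ₗ`; the source enters as `S` in `ScalarFourier.picardMap`). [folklore] -/
def picardMapF (ν T : ℝ) (U G : d → ℝ → (d → ℤ) → ℂ) (a : d → (d → ℤ) → ℂ)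
    (c : d → ℝ → (d → ℤ) → ℂ) (l : d) (t : ℝ) (k : d → ℤ) : ℂ :=
  picardMap ν T U a c l t k + forcing ν T G l t k

/-- Unfolding `picardMapF`. [folklore] -/
theorem picardMapF_apply (ν T : ℝ) (U G : d → ℝ → (d → ℤ) → ℂ) (a : d → (d → ℤ) → ℂ)
    (c : d → ℝ → (d → ℤ) → ℂ) (l : d) (t : ℝ) (k : d → ℤ) :
    picardMapF ν T U G a c l t k = picardMap ν T U a c l t k + forcing ν T G l t k := rfl

/-- The **forced Picard iterates** `c₀ = 0`, `cₙ₊₁ = Φ_G(cₙ)`. [folklore] -/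
def picardIterF (ν T : ℝ) (U G : d → ℝ → (d → ℤ) → ℂ) (a : d → (d → ℤ) → ℂ) :
    ℕ → d → ℝ → (d → ℤ) → ℂ
  | 0 => fun _ _ _ => 0
  | n + 1 => picardMapF ν T U G a (picardIterF ν T U G a n)

/-- `c₀ = 0`. [folklore] -/
@[simp]
theorem picardIterF_zero (ν T : ℝ) (U G : d → ℝ → (d → ℤ) → ℂ) (a : d → (d → ℤ) → ℂ) :
    picardIterF ν T U G a 0 = fun _ _ _ => 0 := rfl

/-- `cₙ₊₁ = Φ_G(cₙ)`. [folklore] -/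
theorem picardIterF_succ (ν T : ℝ) (U G : d → ℝ → (d → ℤ) → ℂ) (a : d → (d → ℤ) → ℂ) (n : ℕ) :
    picardIterF ν T U G a (n + 1) = picardMapF ν T U G a (picardIterF ν T U G a n) := rfl

/-- The **forced Picard limit** `c(l, t, k) = limₙ cₙ(l, t, k)` (pointwise `limUnder`; the
genuine limit under `PicardHypF`, file `LinearisedNSFourierForcedIteration`). [folklore] -/
def picardLimF (ν T : ℝ) (U G : d → ℝ → (d → ℤ) → ℂ) (a : d → (d → ℤ) → ℂ) (l : d) (t : ℝ)
    (k : d → ℤ) : ℂ :=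
  limUnder atTop fun n => picardIterF ν T U G a n l t k

/-- **Hypotheses of the forced Picard iteration**: those of the homogeneous iteration
(`PicardHyp ν T U a`: `ν > 0`, `T > 0`, continuity in time and every decay of the drift
coefficients, every decay of the datum) together with continuity in `t ∈ ℝ` at every frequency
and every polynomial decay, uniformly in `t` and the component, of the source coefficients
`G ⱼ(t)` (in the application: the coefficients of the smooth source at clamped time). [folklore] -/
structure PicardHypF (ν T : ℝ) (U G : d → ℝ → (d → ℤ) → ℂ) (a : d → (d → ℤ) → ℂ) : Prop
    extends PicardHyp ν T U a where
  /-- the source coefficients are continuous in time at each frequency -/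
  contG : ∀ j m, Continuous fun t => G j t m
  /-- every polynomial decay of the source coefficients, uniformly in time and component -/
  decayG : ∀ K : ℕ, ∃ B : ℝ, ∀ j t, HasDecay K B (G j t)

end Picard

/-! ### Families of time derivatives -/

section Family

variable [DecidableEq d]

/-- The **projected source family**: `∑ₘ P(k)ₗₘ · GF m i` (the projector is time independent),
the candidate for `∂ₜⁱ (P ĝ)ₗ` along the source families `GF ⱼ`. [folklore] -/
def srcProjFamily (GF : d → ℕ → ℝ → (d → ℤ) → ℂ) (l : d) : ℕ → ℝ → (d → ℤ) → ℂ :=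
  fun i t k => ∑ m, leraySym l m k * GF m i t k

/-- `srcProjFamily` at order `i` is `srcProj` of the `i`-th members. [folklore] -/
@[simp]
theorem srcProjFamily_apply (GF : d → ℕ → ℝ → (d → ℤ) → ℂ) (l : d) (i : ℕ) (t : ℝ) (k : d → ℤ) :
    srcProjFamily GF l i t k = srcProj (fun j => GF j i t) l k := rfl

/-- The **right-hand side of the differentiated forced mild system** along a velocity family
`CF`: `(bootRHSF ν UF GF CF) l i = -νₖ CF l i - projFamily l i + srcProjFamily GF l i`, the
candidate for `∂ₜ (CF l i)` when `CF l 0 = cₗ` solves `∂ₜcₗ = -νₖ cₗ - (P linSym)ₗ + (P G)ₗ`. [folklore] -/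
def bootRHSF (ν : ℝ) (UF GF CF : d → ℕ → ℝ → (d → ℤ) → ℂ) (l : d) : ℕ → ℝ → (d → ℤ) → ℂ :=
  fun i t k => bootRHS ν UF CF l i t k + srcProjFamily GF l i t k

/-- Unfolding `bootRHSF`. [folklore] -/
theorem bootRHSF_apply (ν : ℝ) (UF GF CF : d → ℕ → ℝ → (d → ℤ) → ℂ) (l : d) (i : ℕ) (t : ℝ)
    (k : d → ℤ) :
    bootRHSF ν UF GF CF l i t k = bootRHS ν UF CF l i t k + srcProjFamily GF l i t k := rfl

end Family

/-! ### The data of a real background, source and datum; the synthesized solution -/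

section Data

variable [DecidableEq d]

/-- The **coefficient field of the solution** of the forced linearised equation on `[0, T]`
with background `u`, source `g` and datum `w₀`: the forced Picard limit for the drift data
`CorrectorFourier.driftCoeff T u`, the source data `CorrectorFourier.driftCoeff T g`
(coefficients of the complexified components at clamped time) and the datum data
`datumCoeff w₀`. [folklore] -/
def solCoeffF (ν T : ℝ) (u g : ℝ → UnitAddTorus d → EuclideanSpace ℝ d)
    (w₀ : UnitAddTorus d → EuclideanSpace ℝ d) : d → ℝ → (d → ℤ) → ℂ :=
  picardLimF ν T (driftCoeff T u) (driftCoeff T g) (datumCoeff w₀)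

/-- The **pressure coefficient field** `q̂(t, k) = presCoefF(U(t), G(t), c(t))(k)`. [folklore] -/
def presCoeffFieldF (ν T : ℝ) (u g : ℝ → UnitAddTorus d → EuclideanSpace ℝ d)
    (w₀ : UnitAddTorus d → EuclideanSpace ℝ d) : ℝ → (d → ℤ) → ℂ :=
  fun t k => presCoefF (fun j => driftCoeff T u j t) (fun j => driftCoeff T g j t)
    (fun j => solCoeffF ν T u g w₀ j t) k

/-- Unfolding `presCoeffFieldF`. [folklore] -/
theorem presCoeffFieldF_apply (ν T : ℝ) (u g : ℝ → UnitAddTorus d → EuclideanSpace ℝ d)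
    (w₀ : UnitAddTorus d → EuclideanSpace ℝ d) (t : ℝ) (k : d → ℤ) :
    presCoeffFieldF ν T u g w₀ t k = presCoefF (fun j => driftCoeff T u j t)
      (fun j => driftCoeff T g j t) (fun j => solCoeffF ν T u g w₀ j t) k := rfl

/-- The **synthesized complex velocity components** `Vₗ(t, x) = ∑ₖ c(l, t, k) e_k(x)`
(`ScalarFourier.torusSynth`; Grafakos 2014, §3.3.1). [folklore] -/
def velCF (ν T : ℝ) (u g : ℝ → UnitAddTorus d → EuclideanSpace ℝ d)
    (w₀ : UnitAddTorus d → EuclideanSpace ℝ d) (l : d) : ℝ → UnitAddTorus d → ℂ :=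
  torusSynth (solCoeffF ν T u g w₀ l)

/-- The **synthesized complex pressure** `Q(t, x) = ∑ₖ q̂(t, k) e_k(x)`. [folklore] -/
def presCF (ν T : ℝ) (u g : ℝ → UnitAddTorus d → EuclideanSpace ℝ d)
    (w₀ : UnitAddTorus d → EuclideanSpace ℝ d) : ℝ → UnitAddTorus d → ℂ :=
  torusSynth (presCoeffFieldF ν T u g w₀)

/-- The **velocity of the solution**: the real vector field with components `Re Vₗ`. [folklore] -/
def velF (ν T : ℝ) (u g : ℝ → UnitAddTorus d → EuclideanSpace ℝ d)
    (w₀ : UnitAddTorus d → EuclideanSpace ℝ d) : ℝ → UnitAddTorus d → EuclideanSpace ℝ d :=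
  fun t x => WithLp.toLp 2 fun l => (velCF ν T u g w₀ l t x).re

/-- The components of `velF`. [folklore] -/
@[simp]
theorem velF_apply (ν T : ℝ) (u g : ℝ → UnitAddTorus d → EuclideanSpace ℝ d)
    (w₀ : UnitAddTorus d → EuclideanSpace ℝ d) (t : ℝ) (x : UnitAddTorus d) (l : d) :
    velF ν T u g w₀ t x l = (velCF ν T u g w₀ l t x).re := rfl

/-- The **pressure of the solution**: `Re Q`. [folklore] -/
def presF (ν T : ℝ) (u g : ℝ → UnitAddTorus d → EuclideanSpace ℝ d)
    (w₀ : UnitAddTorus d → EuclideanSpace ℝ d) : ℝ → UnitAddTorus d → ℝ :=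
  fun t x => (presCF ν T u g w₀ t x).re

/-- Unfolding `presF`. [folklore] -/
@[simp]
theorem presF_apply (ν T : ℝ) (u g : ℝ → UnitAddTorus d → EuclideanSpace ℝ d)
    (w₀ : UnitAddTorus d → EuclideanSpace ℝ d) (t : ℝ) (x : UnitAddTorus d) :
    presF ν T u g w₀ t x = (presCF ν T u g w₀ t x).re := rfl

end Data

end LinearisedNSFourier

end Literature.Analysis.FluidPDE

end
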